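/-
Copyright (c) 2026. All rights reserved.
Released under Apache 2.0 license as described in the file LICENSE.
Authors: abc-iut cell, seat abc-iut-w5-d200 (gen 5).
-/
import Literature.GroupTheory.StronglyCompleteExtension
import Literature.GroupTheory.ProfiniteSubquotients
import Literature.AlgebraicGeometry.Frobenioids.ProfiniteUnitsProofs

/-!
# Abelian-by-abelian (e.g. procyclic-by-procyclic) profinite groups are strongly complete

A profinite group is *strongly complete* when every subgroup of finite index is open (L. Ribes,
P. Zalesskii, *Profinite Groups*, §4.2; spelled out as a conclusion — no definition is introduced).
The abelian case — a topologically finitely generated profinite ABELIAN group has every finite-index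
subgroup open, because the subgroup of `n`-th powers is closed of finite index — is in the tree as
`Literature.AlgebraicGeometry.Frobenioids.IsTfgProfinite.isOpen_of_finiteIndex` (for a `CommGroup`).
This proof-only file (0 definitions) turns it into the forms needed for dévissage and combines it with
abc-iut-w5-d218's extension lemma `isOpen_of_finiteIndex_of_extension`:

* `isOpen_of_finiteIndex_of_forall_commute` — the abelian case for a `Group` whose elements commute
  (commutativity as a hypothesis, so that it applies to subgroups `↥C` and quotients `G ⧸ C`);
* `isOpen_of_finiteIndex_subgroup_of_commute` / `isOpen_of_finiteIndex_quotient_of_commutator_mem` — the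
  two inputs of the extension lemma: a CLOSED, commutative, topologically finitely generated subgroup
  `C` has all finite-index subgroups open (subspace topology); if `G` is topologically finitely generated
  and all commutators lie in the closed normal subgroup `C`, then `G ⧸ C` has all finite-index subgroups
  open (quotient topology);
* `isOpen_of_finiteIndex_of_abelian_by_abelian` — **a topologically finitely generated profinite group
  with a closed normal subgroup `C` that is commutative and topologically finitely generated, and with
  all commutators in `C`, has every finite-index subgroup open**; e.g. every procyclic-by-procyclic
  profinite group such as `Ẑ'(1) ⋊ Ẑ` (the shape of the tame quotient of the absolute Galois group of a
  `p`-adic local field);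
* `forall_isOpen_of_finiteIndex_of_le_iff_quotient` — subgroup form ↔ quotient form of «`G ⧸ P` is
  strongly complete» (finite-index subgroups containing `P` are open iff finite-index subgroups of
  `G ⧸ P` are open);
* `isOpen_of_finiteIndex_of_le_of_abelian_by_abelian_quotient` — the same RELATIVE to a closed normal
  subgroup `P`, in subgroup form (no quotient topology in the statement): if `P ≤ C ≤ G` are closed
  normal subgroups with `⁅C, C⁆ ⊆ P`, `⁅G, G⁆ ⊆ C` and `C` topologically generated by finitely many
  elements modulo `P`, then every finite-index subgroup of `G` CONTAINING `P` is open.  This is the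
  hypothesis «`G ⧸ P` strongly complete» of the wild-inertia reduction (abc-iut STATUS 2026-08-26,
  seat w5-d006, `StronglyCompleteWildReduction`) at the tame-quotient shape.

Intended use (abc-iut, GAP row G-L3d2g2-1): the tame side of «every finite-index subgroup of `G_k` is
open» for a `p`-adic local field `k`; the wild side is NOT touched here.

[cite: RibesZalesskii2010, §4.2] [cite: DDMSAnalyticProP1999, §1.3]
-/

namespace Literature.GroupTheory

namespace StronglyCompleteAbelianByAbelian

open Topology

universe u

variable {G : Type u} [Group G] [TopologicalSpace G] [IsTopologicalGroup G] [CompactSpace G]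
  [TotallyDisconnectedSpace G]

/-- **Abelian case, commutativity as a hypothesis.** In a compact Hausdorff totally disconnected
topological group whose elements pairwise commute and which is topologically generated by a finite set,
every finite-index subgroup is open (the subgroup of `n`-th powers is a closed subgroup of finite index;
`IsTfgProfinite.isOpen_of_finiteIndex`). [cite: RibesZalesskii2010, §4.2] -/
theorem isOpen_of_finiteIndex_of_forall_commute [T2Space G] (hcomm : ∀ x y : G, x * y = y * x)
    (hS : ∃ S : Finset G, Dense ((Subgroup.closure (S : Set G) : Subgroup G) : Set G))
    (L : Subgroup G) [L.FiniteIndex] : IsOpen (L : Set G) := by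
  letI : CommGroup G := { ‹Group G› with mul_comm := hcomm }
  have h : Literature.AlgebraicGeometry.Frobenioids.IsTfgProfinite G :=
    ⟨inferInstance, inferInstance, inferInstance, inferInstance, hS⟩
  exact h.isOpen_of_finiteIndex L

omit [IsTopologicalGroup G] [CompactSpace G] [TotallyDisconnectedSpace G] in
/-- A subgroup `C` topologically generated by a finite subset `T ⊆ C` of `G` (i.e. `C` lies in the
closure of the subgroup generated by `T`) is topologically finitely generated in its subspace topology.
[cite: RibesZalesskii2010, §4.2] -/
theorem exists_finset_dense_subgroup (C : Subgroup G) {T : Finset G} (hTC : (T : Set G) ⊆ C)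
    (hCT : (C : Set G) ⊆ closure ((Subgroup.closure (T : Set G) : Subgroup G) : Set G)) :
    ∃ S : Finset C, Dense ((Subgroup.closure (S : Set C) : Subgroup C) : Set C) := by
  classical
  -- the finite set `T`, seen inside `C`
  let f : T → C := fun t => ⟨(t : G), hTC t.2⟩
  refine ⟨Finset.univ.image f, ?_⟩
  have hSimg : ((↑) : C → G) '' ((Finset.univ.image f : Finset C) : Set C) = (T : Set G) := by
    ext x
    simp only [Finset.coe_image, Finset.coe_univ, Set.image_univ, Set.mem_image, Set.mem_range,
      Finset.mem_coe]
    constructor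
    · rintro ⟨c, ⟨t, rfl⟩, rfl⟩
      exact t.2
    · intro hx
      exact ⟨f ⟨x, hx⟩, ⟨⟨x, hx⟩, rfl⟩, rfl⟩
  have hmap : ((↑) : C → G) '' ((Subgroup.closure ((Finset.univ.image f : Finset C) : Set C) :
      Subgroup C) : Set C) = ((Subgroup.closure (T : Set G) : Subgroup G) : Set G) := by
    rw [← Subgroup.coe_subtype, ← Subgroup.coe_map, MonoidHom.map_closure, Subgroup.coe_subtype,
      hSimg]
  rw [Subtype.dense_iff]
  intro x hx
  have hx' : x ∈ closure (((↑) : C → G) '' ((Subgroup.closure ((Finset.univ.image f : Finset C) :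
      Set C) : Subgroup C) : Set C)) := by
    rw [hmap]
    exact hCT hx
  exact hx'

omit [IsTopologicalGroup G] [CompactSpace G] [TotallyDisconnectedSpace G] in
/-- Topological finite generation passes to quotients: the images of the generators generate a dense
subgroup of `G ⧸ N`. [cite: RibesZalesskii2010, §4.2] -/
theorem exists_finset_dense_quotient (N : Subgroup G) [N.Normal]
    (hS : ∃ S : Finset G, Dense ((Subgroup.closure (S : Set G) : Subgroup G) : Set G)) :
    ∃ S : Finset (G ⧸ N), Dense ((Subgroup.closure (S : Set (G ⧸ N)) : Subgroup (G ⧸ N)) :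
      Set (G ⧸ N)) := by
  classical
  obtain ⟨S, hSd⟩ := hS
  refine ⟨S.image (QuotientGroup.mk' N), ?_⟩
  have hco : ((Subgroup.closure ((S.image (QuotientGroup.mk' N) : Finset (G ⧸ N)) : Set (G ⧸ N)) :
      Subgroup (G ⧸ N)) : Set (G ⧸ N)) = (QuotientGroup.mk' N) '' ((Subgroup.closure (S : Set G) :
      Subgroup G) : Set G) := by
    rw [Finset.coe_image, ← MonoidHom.map_closure, Subgroup.coe_map]
  rw [hco]
  exact (QuotientGroup.mk'_surjective N).denseRange.dense_image QuotientGroup.continuous_mk hSd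

/-- **Input `hC` of the extension lemma.** A CLOSED subgroup `C` of a compact Hausdorff totally
disconnected group whose elements pairwise commute and which is topologically generated by a finite
subset has all its finite-index subgroups open in the subspace topology.
[cite: RibesZalesskii2010, §4.2] -/
theorem isOpen_of_finiteIndex_subgroup_of_commute [T2Space G]
    (C : Subgroup G) (hCc : IsClosed (C : Set G))
    (hcomm : ∀ x ∈ C, ∀ y ∈ C, x * y = y * x)
    (hS : ∃ S : Finset C, Dense ((Subgroup.closure (S : Set C) : Subgroup C) : Set C))
    (V : Subgroup C) [V.FiniteIndex] : IsOpen (V : Set C) := by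
  haveI : CompactSpace C := ProfiniteSubquotients.compactSpace_of_isClosed hCc
  exact isOpen_of_finiteIndex_of_forall_commute
    (fun x y => Subtype.ext (hcomm x x.2 y y.2)) hS V

omit [TopologicalSpace G] [IsTopologicalGroup G] [CompactSpace G] [TotallyDisconnectedSpace G] in
/-- If all commutators of `G` lie in the normal subgroup `C`, the quotient `G ⧸ C` is commutative.
[cite: RibesZalesskii2010, §4.2] -/
theorem quotient_mul_comm_of_commutator_mem (C : Subgroup G) [C.Normal]
    (hGC : ∀ x y : G, x * y * x⁻¹ * y⁻¹ ∈ C) (a b : G ⧸ C) : a * b = b * a := by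
  obtain ⟨x, rfl⟩ := QuotientGroup.mk_surjective a
  obtain ⟨y, rfl⟩ := QuotientGroup.mk_surjective b
  rw [← QuotientGroup.mk_mul, ← QuotientGroup.mk_mul, QuotientGroup.eq]
  have h := hGC y⁻¹ x⁻¹
  simpa [mul_assoc] using h

/-- **Input `hQ` of the extension lemma.** If `G` is a compact totally disconnected group topologically
generated by a finite set and `C` is a closed normal subgroup containing all commutators, then every
finite-index subgroup of `G ⧸ C` (quotient topology) is open. [cite: RibesZalesskii2010, §4.2] -/
theorem isOpen_of_finiteIndex_quotient_of_commutator_mem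
    (C : Subgroup G) [C.Normal] (hCc : IsClosed (C : Set G)) (hGC : ∀ x y : G, x * y * x⁻¹ * y⁻¹ ∈ C)
    (hS : ∃ S : Finset G, Dense ((Subgroup.closure (S : Set G) : Subgroup G) : Set G))
    (W : Subgroup (G ⧸ C)) [W.FiniteIndex] : IsOpen (W : Set (G ⧸ C)) := by
  haveI : IsClosed (C : Set G) := hCc
  haveI : TotallyDisconnectedSpace (G ⧸ C) :=
    ProfiniteSubquotients.totallyDisconnectedSpace_quotient C hCc
  exact isOpen_of_finiteIndex_of_forall_commute (quotient_mul_comm_of_commutator_mem C hGC)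
    (exists_finset_dense_quotient C hS) W

/-- **Abelian-by-(strongly complete).** If a closed normal subgroup `C` of a profinite group `G` is
commutative and topologically finitely generated, and every finite-index subgroup of `G ⧸ C` is open,
then every finite-index subgroup of `G` is open. [cite: RibesZalesskii2010, §4.2] -/
theorem isOpen_of_finiteIndex_of_abelian_by [T2Space G] (C : Subgroup G) [C.Normal]
    (hCc : IsClosed (C : Set G)) (hcomm : ∀ x ∈ C, ∀ y ∈ C, x * y = y * x)
    (hT : ∃ S : Finset C, Dense ((Subgroup.closure (S : Set C) : Subgroup C) : Set C))
    (hQ : ∀ W : Subgroup (G ⧸ C), W.FiniteIndex → IsOpen (W : Set (G ⧸ C)))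
    (H : Subgroup G) [H.FiniteIndex] : IsOpen (H : Set G) :=
  isOpen_of_finiteIndex_of_extension C
    (fun V hV => by haveI := hV; exact isOpen_of_finiteIndex_subgroup_of_commute C hCc hcomm hT V) hQ H

/-- **(Strongly complete)-by-abelian.** If `G` is a topologically finitely generated profinite group and
`C` a closed normal subgroup containing all commutators such that every finite-index subgroup of `C` is
open in `C`, then every finite-index subgroup of `G` is open. [cite: RibesZalesskii2010, §4.2] -/
theorem isOpen_of_finiteIndex_of_by_abelian (C : Subgroup G) [C.Normal]
    (hCc : IsClosed (C : Set G)) (hGC : ∀ x y : G, x * y * x⁻¹ * y⁻¹ ∈ C)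
    (hS : ∃ S : Finset G, Dense ((Subgroup.closure (S : Set G) : Subgroup G) : Set G))
    (hC : ∀ V : Subgroup C, V.FiniteIndex → IsOpen (V : Set C))
    (H : Subgroup G) [H.FiniteIndex] : IsOpen (H : Set G) :=
  isOpen_of_finiteIndex_of_extension C hC
    (fun W hW => by
      haveI := hW; exact isOpen_of_finiteIndex_quotient_of_commutator_mem C hCc hGC hS W) H

/-- **Abelian-by-abelian profinite groups are strongly complete.** Let `G` be a compact Hausdorff
totally disconnected group topologically generated by a finite set, and `C` a closed normal subgroup
which is commutative, topologically generated by a finite subset, and contains every commutator of `G`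
(so `G ⧸ C` is abelian).  Then every finite-index subgroup of `G` is open.  Examples: every
procyclic-by-procyclic profinite group, e.g. `Ẑ'(1) ⋊ Ẑ`. [cite: RibesZalesskii2010, §4.2] -/
theorem isOpen_of_finiteIndex_of_abelian_by_abelian [T2Space G] (C : Subgroup G) [C.Normal]
    (hCc : IsClosed (C : Set G)) (hcomm : ∀ x ∈ C, ∀ y ∈ C, x * y = y * x)
    (hT : ∃ S : Finset C, Dense ((Subgroup.closure (S : Set C) : Subgroup C) : Set C))
    (hGC : ∀ x y : G, x * y * x⁻¹ * y⁻¹ ∈ C)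
    (hS : ∃ S : Finset G, Dense ((Subgroup.closure (S : Set G) : Subgroup G) : Set G))
    (H : Subgroup G) [H.FiniteIndex] : IsOpen (H : Set G) :=
  isOpen_of_finiteIndex_of_abelian_by C hCc hcomm hT
    (fun W hW => by
      haveI := hW; exact isOpen_of_finiteIndex_quotient_of_commutator_mem C hCc hGC hS W) H

/-- The same with the generators of `C` given as a finite subset `T ⊆ C` of `G`.
[cite: RibesZalesskii2010, §4.2] -/
theorem isOpen_of_finiteIndex_of_abelian_by_abelian' [T2Space G] (C : Subgroup G) [C.Normal]
    (hCc : IsClosed (C : Set G)) (hcomm : ∀ x ∈ C, ∀ y ∈ C, x * y = y * x)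
    {T : Finset G} (hTC : (T : Set G) ⊆ C)
    (hCT : (C : Set G) ⊆ closure ((Subgroup.closure (T : Set G) : Subgroup G) : Set G))
    (hGC : ∀ x y : G, x * y * x⁻¹ * y⁻¹ ∈ C)
    (hS : ∃ S : Finset G, Dense ((Subgroup.closure (S : Set G) : Subgroup G) : Set G))
    (H : Subgroup G) [H.FiniteIndex] : IsOpen (H : Set G) :=
  isOpen_of_finiteIndex_of_abelian_by_abelian C hCc hcomm (exists_finset_dense_subgroup C hTC hCT)
    hGC hS H

omit [CompactSpace G] [TotallyDisconnectedSpace G] in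
/-- **Subgroup form ↔ quotient form** of «`G ⧸ P` is strongly complete», for a normal subgroup `P` of a
topological group `G`: every finite-index subgroup of `G` containing `P` is open iff every finite-index
subgroup of `G ⧸ P` is open in the quotient topology (the projection is a continuous open surjection).
[cite: RibesZalesskii2010, §4.2] -/
theorem forall_isOpen_of_finiteIndex_of_le_iff_quotient (P : Subgroup G) [P.Normal] :
    (∀ K : Subgroup G, K.FiniteIndex → P ≤ K → IsOpen (K : Set G)) ↔
      (∀ W : Subgroup (G ⧸ P), W.FiniteIndex → IsOpen (W : Set (G ⧸ P))) := by
  have hπs : Function.Surjective (QuotientGroup.mk' P) := QuotientGroup.mk'_surjective P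
  constructor
  · intro h W hW
    -- `W` is the image of its preimage, which contains `P`, has finite index and is open
    haveI : (W.comap (QuotientGroup.mk' P)).FiniteIndex := by
      refine ⟨?_⟩
      rw [Subgroup.index_comap_of_surjective W hπs]
      exact hW.index_ne_zero
    have hPle : P ≤ W.comap (QuotientGroup.mk' P) := by
      intro x hx
      rw [Subgroup.mem_comap, QuotientGroup.mk'_apply, (QuotientGroup.eq_one_iff x).mpr hx]
      exact W.one_mem
    have hK : IsOpen ((W.comap (QuotientGroup.mk' P) : Subgroup G) : Set G) :=
      h _ inferInstance hPle
    have himg : IsOpen ((QuotientGroup.mk : G → G ⧸ P) ''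
        ((W.comap (QuotientGroup.mk' P) : Subgroup G) : Set G)) :=
      QuotientGroup.isOpenMap_coe _ hK
    have hset : (QuotientGroup.mk : G → G ⧸ P) ''
        ((W.comap (QuotientGroup.mk' P) : Subgroup G) : Set G) = (W : Set (G ⧸ P)) :=
      Set.image_preimage_eq (W : Set (G ⧸ P)) QuotientGroup.mk_surjective
    rw [hset] at himg
    exact himg
  · intro h K hK hPK
    have hπker : (QuotientGroup.mk' P).ker = P := QuotientGroup.ker_mk' P
    haveI : (K.map (QuotientGroup.mk' P)).FiniteIndex := by
      refine ⟨fun h0 => ?_⟩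
      have hdvd := Subgroup.index_map_dvd K hπs
      rw [h0, zero_dvd_iff] at hdvd
      exact hK.index_ne_zero hdvd
    have hpre : IsOpen ((QuotientGroup.mk' P : G → G ⧸ P) ⁻¹'
        ((K.map (QuotientGroup.mk' P) : Subgroup (G ⧸ P)) : Set (G ⧸ P))) :=
      (h _ inferInstance).preimage QuotientGroup.continuous_mk
    rw [← Subgroup.coe_comap, Subgroup.comap_map_eq_self (by rw [hπker]; exact hPK)] at hpre
    exact hpre

/-- **Relative (subgroup) form: finite-index subgroups above a closed normal `P` with abelian-by-abelian
quotient are open.** Let `G` be a compact Hausdorff totally disconnected group topologically generated by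
a finite set, and `P ≤ C` closed normal subgroups of `G` such that all commutators of elements of `C`
lie in `P`, all commutators of `G` lie in `C`, and `C` is contained in the closure of the subgroup
generated by `P` and a finite set `T ⊆ C`.  Then every finite-index subgroup `K` of `G` with `P ≤ K` is
open.  (No quotient topology appears in the statement; the proof passes to `G ⧸ P`.)  For the absolute
Galois group of a `p`-adic local field with `P` the wild inertia subgroup and `C` the inertia subgroup
(`C ⧸ P ≅ Ẑ'(1)` procyclic, `G ⧸ C ≅ Ẑ`) this is the hypothesis «every finite-index subgroup containing
the wild inertia is open». [cite: RibesZalesskii2010, §4.2] -/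
theorem isOpen_of_finiteIndex_of_le_of_abelian_by_abelian_quotient [T2Space G]
    (P C : Subgroup G) [P.Normal] [C.Normal] (hPc : IsClosed (P : Set G)) (hCc : IsClosed (C : Set G))
    (hCP : ∀ x ∈ C, ∀ y ∈ C, x * y * x⁻¹ * y⁻¹ ∈ P) (hGC : ∀ x y : G, x * y * x⁻¹ * y⁻¹ ∈ C)
    {T : Finset G} (hTC : (T : Set G) ⊆ C)
    (hCT : (C : Set G) ⊆ closure ((Subgroup.closure (T : Set G) ⊔ P : Subgroup G) : Set G))
    (hS : ∃ S : Finset G, Dense ((Subgroup.closure (S : Set G) : Subgroup G) : Set G))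
    (K : Subgroup G) [K.FiniteIndex] (hPK : P ≤ K) : IsOpen (K : Set G) := by
  classical
  haveI : IsClosed (P : Set G) := hPc
  haveI : TotallyDisconnectedSpace (G ⧸ P) :=
    ProfiniteSubquotients.totallyDisconnectedSpace_quotient P hPc
  -- the projection
  set π : G →* G ⧸ P := QuotientGroup.mk' P with hπ
  have hπc : Continuous π := QuotientGroup.continuous_mk
  have hπs : Function.Surjective π := QuotientGroup.mk'_surjective P
  have hπker : π.ker = P := by rw [hπ, QuotientGroup.ker_mk']
  -- the image `C'` of `C` is a closed normal commutative subgroup of `G ⧸ P`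
  set C' : Subgroup (G ⧸ P) := C.map π with hC'
  haveI : C'.Normal := Subgroup.Normal.map inferInstance π hπs
  have hC'c : IsClosed (C' : Set (G ⧸ P)) := by
    rw [hC', Subgroup.coe_map]
    exact (hCc.isCompact.image hπc).isClosed
  have hC'comm : ∀ x ∈ C', ∀ y ∈ C', x * y = y * x := by
    rintro _ ⟨x, hx, rfl⟩ _ ⟨y, hy, rfl⟩
    rw [← map_mul, ← map_mul, hπ, QuotientGroup.mk'_apply, QuotientGroup.mk'_apply, QuotientGroup.eq]
    have h := hCP y⁻¹ (C.inv_mem hy) x⁻¹ (C.inv_mem hx)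
    simpa [mul_assoc] using h
  -- `C'` is topologically generated by the image of `T`
  have hT'C : ((T.image π : Finset (G ⧸ P)) : Set (G ⧸ P)) ⊆ C' := by
    rw [Finset.coe_image, hC', Subgroup.coe_map]
    exact Set.image_mono hTC
  have hmapP : (Subgroup.closure (T : Set G) ⊔ P).map π =
      Subgroup.closure ((T.image π : Finset (G ⧸ P)) : Set (G ⧸ P)) := by
    rw [Subgroup.map_sup, (Subgroup.map_eq_bot_iff P).mpr (by rw [hπker]), sup_bot_eq,
      MonoidHom.map_closure, Finset.coe_image]
  have hC'T : (C' : Set (G ⧸ P)) ⊆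
      closure ((Subgroup.closure ((T.image π : Finset (G ⧸ P)) : Set (G ⧸ P)) :
        Subgroup (G ⧸ P)) : Set (G ⧸ P)) := by
    rw [hC', Subgroup.coe_map, ← hmapP, Subgroup.coe_map]
    exact (Set.image_mono hCT).trans (image_closure_subset_closure_image hπc)
  -- all commutators of `G ⧸ P` lie in `C'`, and `G ⧸ P` is topologically finitely generated
  have hGC' : ∀ a b : G ⧸ P, a * b * a⁻¹ * b⁻¹ ∈ C' := by
    intro a b
    obtain ⟨x, rfl⟩ := hπs a
    obtain ⟨y, rfl⟩ := hπs b
    have h : π (x * y * x⁻¹ * y⁻¹) ∈ C' := Subgroup.mem_map_of_mem π (hGC x y)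
    simpa only [map_mul, map_inv] using h
  have hS' := exists_finset_dense_quotient P hS
  -- the image of `K` has finite index, hence is open; pull back
  haveI : (K.map π).FiniteIndex := by
    refine ⟨fun h0 => ?_⟩
    have hdvd := Subgroup.index_map_dvd K hπs
    rw [h0, zero_dvd_iff] at hdvd
    exact Subgroup.FiniteIndex.index_ne_zero hdvd
  have hopen : IsOpen ((K.map π : Subgroup (G ⧸ P)) : Set (G ⧸ P)) :=
    isOpen_of_finiteIndex_of_abelian_by_abelian' C' hC'c hC'comm hT'C hC'T hGC' hS' (K.map π)
  have hpre : IsOpen ((π : G → G ⧸ P) ⁻¹' ((K.map π : Subgroup (G ⧸ P)) : Set (G ⧸ P))) :=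
    hopen.preimage hπc
  rw [← Subgroup.coe_comap, Subgroup.comap_map_eq_self (by rw [hπker]; exact hPK)] at hpre
  exact hpre

end StronglyCompleteAbelianByAbelian

end Literature.GroupTheory
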